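import Summits.CriticalPhenomena.CardyFormulaZ2.Theorems.CardyFlipRussoVoronoiHubFromSmirnovWardFarField
import Literature.Probability.Percolation.VoronoiCrossing

/-!
# The crossing event is black-increasing almost surely (line `moebius-exact-delaunay-dilation-ward`,
# stub `crossProb_insert_mono` toward S2′ `stub_wardBound`)
# (crux `VoronoiHubFromSmirnov`, stmt-CriticalPhenomena-6433)

Structurally the annealed insertion response of the line splits as
`insResp = (P[black insertion at z gives a crossing] − P[crossing]) + (P[white insertion at z gives
a crossing] − P[crossing]) = gain + loss` with `gain ≥ 0 ≥ loss`; this file proves the two sign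
statements, i.e. `crossProb ≤ P{(c.1 ∪ {z}, c.2) ∈ E}` and `P{(c.1, c.2 ∪ {z}) ∈ E} ≤ crossProb`
(`crossProb_insert_mono`).

The crossing event `crossEvent R δ` is, definitionally, the continuum Voronoi crossing event
`Literature.Probability.Percolation.voronoiCrossing` of Bollobás–Riordan (2006), Ch. 8 §8.2, read on
pairs of configurations (`im_mem_crossEvent_iff`), and that event is black-increasing
(`voronoiCrossing.mono`: adding black nuclei and deleting white nuclei enlarges the closed black
region) — but only for configurations whose two colour classes are NON-EMPTY, because of the junk
value `infDist · ∅ = 0` (for `c.1 = ∅` every point is black).  Under `lawBW (intensity ρ t δ)` both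
classes are non-empty almost surely: the empty configuration has no point in any disc `B(0, n)`,
an event of probability `exp (-μ(B(0,n))) ≤ exp (-(min 1 (inf ρ)) π n²) → 0` (void probabilities
`lawBW_real_countFst/Snd_eq_zero`, the lower bound `ofReal_mul_volume_le_intensity` of the far-field
file).  The two inequalities follow by outer-measure monotonicity and subadditivity (no
measurability of the crossing event is used).  No new definitions.
(Bollobás–Riordan 2006 Ch. 8 §8.2 for monotonicity; Last–Penrose 2017 Ch. 3 for void probabilities.)
-/

noncomputable section

namespace Summit.CriticalPhenomena.CardyFormulaZ2.Cruxes.VoronoiHubFromSmirnov.MoebiusExactDelaunayDilationWard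

open scoped Topology ENNReal
open Filter Set MeasureTheory Metric
open Literature.Analysis.FunctionSpaces
open Literature.Probability.RandomPlanarGeometry

/-! ### The crossing event is the literature's Voronoi crossing event; monotonicity -/

/-- `crossEvent R δ` is, definitionally, Bollobás–Riordan's continuum Voronoi crossing event of
`Ω = R.carrier` between the arcs `R.arc 0` and `R.arc 2` at scale `δ`, for the nucleus sets
`(c.1, c.2)`. [folklore] -/
theorem im_mem_crossEvent_iff {R : ConformalRectangle} {δ : ℝ} {c : PointConfig ℂ × PointConfig ℂ} :
    c ∈ crossEvent R δ ↔ Literature.Probability.Percolation.voronoiCrossing R.carrier (R.arc 0)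
      (R.arc 2) δ (c.1 : Set ℂ) (c.2 : Set ℂ) :=
  Iff.rfl

/-- As sets of points, `c ⊆ c ∪ {z}`. [folklore] -/
theorem im_coe_subset_insertAt (z : ℂ) (c : PointConfig ℂ) :
    (c : Set ℂ) ⊆ (insertAt z c : Set ℂ) :=
  fun _ hy => mem_insertAt.2 (Or.inl hy)

/-- **Black insertion preserves crossings** (the crossing event is black-increasing,
Bollobás–Riordan 2006 Ch. 8 §8.2), for configurations with both colour classes non-empty.
[folklore] -/
theorem im_insertFst_mem_of_mem {R : ConformalRectangle} {δ : ℝ} {z : ℂ}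
    {c : PointConfig ℂ × PointConfig ℂ} (h1 : (c.1 : Set ℂ).Nonempty) (h2 : (c.2 : Set ℂ).Nonempty)
    (hc : c ∈ crossEvent R δ) : (insertAt z c.1, c.2) ∈ crossEvent R δ :=
  im_mem_crossEvent_iff.2
    ((im_mem_crossEvent_iff.1 hc).mono (im_coe_subset_insertAt z c.1) h1 Subset.rfl h2)

/-- **White insertion destroys no non-crossing** (the crossing event is white-decreasing,
Bollobás–Riordan 2006 Ch. 8 §8.2), for configurations with both colour classes non-empty.
[folklore] -/
theorem im_mem_of_insertSnd_mem {R : ConformalRectangle} {δ : ℝ} {z : ℂ}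
    {c : PointConfig ℂ × PointConfig ℂ} (h1 : (c.1 : Set ℂ).Nonempty) (h2 : (c.2 : Set ℂ).Nonempty)
    (hc : (c.1, insertAt z c.2) ∈ crossEvent R δ) : c ∈ crossEvent R δ :=
  im_mem_crossEvent_iff.2
    ((im_mem_crossEvent_iff.1 hc).mono Subset.rfl h1 (im_coe_subset_insertAt z c.2) h2)

/-! ### Both colour classes are non-empty almost surely -/

/-- A configuration without points has count `0` in every set. [folklore] -/
theorem im_count_eq_zero_of_not_nonempty {c : PointConfig ℂ} (h : ¬ (c : Set ℂ).Nonempty)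
    (B : Set ℂ) : c.count B = 0 := by
  have h' : c.carrier = ∅ := Set.not_nonempty_iff_eq_empty.1 h
  simp [PointConfig.count, h']

/-- A real number below `exp (-(a n²))` for every `n : ℕ` (`a > 0`) is `≤ 0`. [folklore] -/
theorem im_le_zero_of_forall_le_exp {x a : ℝ} (ha : 0 < a)
    (h : ∀ n : ℕ, x ≤ Real.exp (-(a * (n : ℝ) ^ 2))) : x ≤ 0 := by
  have hlim : Tendsto (fun n : ℕ => Real.exp (-(a * (n : ℝ) ^ 2))) atTop (𝓝 0) :=
    Real.tendsto_exp_neg_atTop_nhds_zero.comp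
      (((tendsto_pow_atTop two_ne_zero).comp tendsto_natCast_atTop_atTop).const_mul_atTop ha)
  exact ge_of_tendsto' hlim h

/-- The intensity `intensity ρ t δ` of a continuous profile is locally finite. [folklore] -/
theorem im_isLocallyFiniteMeasure_intensity {ρ : ℂ → ℝ} (hρ : Continuous ρ) (t δ : ℝ) :
    IsLocallyFiniteMeasure (intensity ρ t δ) := by
  unfold intensity
  exact IsLocallyFiniteMeasure.withDensity_ofReal (continuous_densityPath_mul ρ hρ t δ)

/-- An event of `lawBW (intensity ρ t δ)` (`ρ` admissible, `t ∈ [0,1]`) whose probability is below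
the void probability `exp (-μ(B(0,n)))` of every disc `B(0, n)` is null: `μ(B(0,n)) ≥ m₀ π n²` with
`m₀ = min 1 (inf ρ) > 0`. [folklore] -/
theorem im_measureReal_eq_zero_of_le_exp {ρ : ℂ → ℝ} (hρ : AdmissibleDensity ρ) {t : ℝ}
    (ht : t ∈ Icc (0:ℝ) 1) (δ : ℝ) {N : Set (PointConfig ℂ × PointConfig ℂ)}
    (hN : ∀ n : ℕ, (lawBW (intensity ρ t δ)).real N ≤
      Real.exp (-((intensity ρ t δ) (ball (0:ℂ) n)).toReal)) :
    (lawBW (intensity ρ t δ)).real N = 0 := by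
  obtain ⟨m, hm0, hm⟩ := hρ.exists_pos_forall_le
  have hm₀ : 0 < min 1 m := lt_min one_pos hm0
  have hmd : ∀ x, min 1 m ≤ densityPath ρ t x := fun x => min_le_densityPath hm ht x
  haveI := im_isLocallyFiniteMeasure_intensity hρ.continuous t δ
  refine le_antisymm (im_le_zero_of_forall_le_exp (mul_pos hm₀ Real.pi_pos) fun n => ?_)
    measureReal_nonneg
  have hfin : (intensity ρ t δ) (ball (0:ℂ) n) ≠ ∞ := measure_ball_ne_top
  refine (hN n).trans ?_
  rw [Real.exp_le_exp, neg_le_neg_iff, mul_assoc]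
  have hle := ofReal_mul_volume_le_intensity hmd δ
    (measurableSet_ball : MeasurableSet (ball (0:ℂ) n))
  have h := ENNReal.toReal_mono hfin hle
  rwa [ENNReal.toReal_mul, ENNReal.toReal_ofReal hm₀.le,
    volume_real_complex_ball _ (Nat.cast_nonneg n)] at h

/-- Under `lawBW (intensity ρ t δ)` the BLACK configuration is non-empty almost surely.
[folklore] -/
theorem im_lawBW_real_fst_not_nonempty {ρ : ℂ → ℝ} (hρ : AdmissibleDensity ρ) {t : ℝ}
    (ht : t ∈ Icc (0:ℝ) 1) (δ : ℝ) :
    (lawBW (intensity ρ t δ)).real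
      {c : PointConfig ℂ × PointConfig ℂ | ¬ (c.1 : Set ℂ).Nonempty} = 0 := by
  have hP := isPoissonPointProcess_poissonLaw_intensity ρ hρ.continuous t δ
  haveI := isProbabilityMeasure_lawBW_intensity ρ hρ.continuous t δ
  haveI := im_isLocallyFiniteMeasure_intensity hρ.continuous t δ
  refine im_measureReal_eq_zero_of_le_exp hρ ht δ fun n => ?_
  rw [← lawBW_real_countFst_eq_zero hP measurableSet_ball measure_ball_ne_top]
  exact measureReal_mono (fun c hc => im_count_eq_zero_of_not_nonempty hc (ball (0:ℂ) n))
    (measure_ne_top _ _)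

/-- Under `lawBW (intensity ρ t δ)` the WHITE configuration is non-empty almost surely.
[folklore] -/
theorem im_lawBW_real_snd_not_nonempty {ρ : ℂ → ℝ} (hρ : AdmissibleDensity ρ) {t : ℝ}
    (ht : t ∈ Icc (0:ℝ) 1) (δ : ℝ) :
    (lawBW (intensity ρ t δ)).real
      {c : PointConfig ℂ × PointConfig ℂ | ¬ (c.2 : Set ℂ).Nonempty} = 0 := by
  have hP := isPoissonPointProcess_poissonLaw_intensity ρ hρ.continuous t δ
  haveI := isProbabilityMeasure_lawBW_intensity ρ hρ.continuous t δ
  haveI := im_isLocallyFiniteMeasure_intensity hρ.continuous t δ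
  refine im_measureReal_eq_zero_of_le_exp hρ ht δ fun n => ?_
  rw [← lawBW_real_countSnd_eq_zero hP measurableSet_ball measure_ball_ne_top]
  exact measureReal_mono (fun c hc => im_count_eq_zero_of_not_nonempty hc (ball (0:ℂ) n))
    (measure_ne_top _ _)

/-- Under `lawBW (intensity ρ t δ)` both colour classes are non-empty almost surely. [folklore] -/
theorem im_lawBW_real_degenerate {ρ : ℂ → ℝ} (hρ : AdmissibleDensity ρ) {t : ℝ}
    (ht : t ∈ Icc (0:ℝ) 1) (δ : ℝ) :
    (lawBW (intensity ρ t δ)).real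
      ({c : PointConfig ℂ × PointConfig ℂ | ¬ (c.1 : Set ℂ).Nonempty} ∪
        {c | ¬ (c.2 : Set ℂ).Nonempty}) = 0 :=
  measureReal_union_null (im_lawBW_real_fst_not_nonempty hρ ht δ)
    (im_lawBW_real_snd_not_nonempty hρ ht δ)

/-! ### Probabilities -/

/-- If `A ⊆ B ∪ N` with `N` null then `P(A) ≤ P(B)` (outer-measure monotonicity and subadditivity;
no measurability). [folklore] -/
theorem im_measureReal_le_of_subset_union_null {α : Type*} [MeasurableSpace α] {μ : Measure α}
    [IsFiniteMeasure μ] {A B N : Set α} (hN : μ.real N = 0) (h : A ⊆ B ∪ N) :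
    μ.real A ≤ μ.real B :=
  calc μ.real A ≤ μ.real (B ∪ N) := measureReal_mono h (measure_ne_top μ _)
    _ ≤ μ.real B + μ.real N := measureReal_union_le _ _
    _ = μ.real B := by rw [hN, add_zero]

/-- **The crossing event is black-increasing, almost surely** (stub `crossProb_insert_mono` of the
line): in every admissible environment `ρ_t`, `t ∈ [0,1]`, inserting a BLACK nucleus at `z` can only
create crossings and inserting a WHITE one can only destroy them, in probability:
`crossProb ≤ P{(c.1 ∪ {z}, c.2) ∈ E}` and `P{(c.1, c.2 ∪ {z}) ∈ E} ≤ crossProb`; hence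
`insResp = gain + loss` with `gain ≥ 0 ≥ loss`.  (Bollobás–Riordan 2006 Ch. 8 §8.2 monotonicity off
the null event that a colour class is empty; the mesh hypothesis is not used.) [folklore] -/
theorem crossProb_insert_mono : ∀ (ρ : ℂ → ℝ) (t : ℝ) (R : ConformalRectangle) (δ : ℝ) (z : ℂ), AdmissibleDensity ρ → t ∈ Set.Icc (0:ℝ) 1 → 0 < δ → crossProb ρ t R δ ≤ (lawBW (intensity ρ t δ)).real {c | (insertAt z c.1, c.2) ∈ crossEvent R δ} ∧ (lawBW (intensity ρ t δ)).real {c | (c.1, insertAt z c.2) ∈ crossEvent R δ} ≤ crossProb ρ t R δ := by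
  intro ρ t R δ z hρ ht _hδ
  haveI := isProbabilityMeasure_lawBW_intensity ρ hρ.continuous t δ
  have hN := im_lawBW_real_degenerate hρ ht δ
  unfold crossProb
  refine ⟨im_measureReal_le_of_subset_union_null hN fun c hc => ?_,
    im_measureReal_le_of_subset_union_null hN fun c hc => ?_⟩
  · -- a crossing survives a black insertion unless a colour class is empty
    simp only [Set.mem_union, Set.mem_setOf_eq]
    by_cases h1 : (c.1 : Set ℂ).Nonempty
    · by_cases h2 : (c.2 : Set ℂ).Nonempty
      · exact Or.inl (im_insertFst_mem_of_mem h1 h2 hc)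
      · exact Or.inr (Or.inr h2)
    · exact Or.inr (Or.inl h1)
  · -- a crossing after a white insertion was a crossing, unless a colour class is empty
    simp only [Set.mem_union, Set.mem_setOf_eq] at hc ⊢
    by_cases h1 : (c.1 : Set ℂ).Nonempty
    · by_cases h2 : (c.2 : Set ℂ).Nonempty
      · exact Or.inl (im_mem_of_insertSnd_mem h1 h2 hc)
      · exact Or.inr (Or.inr h2)
    · exact Or.inr (Or.inl h1)

end Summit.CriticalPhenomena.CardyFormulaZ2.Cruxes.VoronoiHubFromSmirnov.MoebiusExactDelaunayDilationWard

end
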